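import Summits.NavierStokesRegularity.FluidComputer.LipschitzSummation
import HarnessLib

/-!
# Fluid computer — support: tools for the `Ḃ^{5/2}_{2,1}` row `P = ∑_l 2^{5l/2} ‖Δ̇_l u‖₂` — a square-root comparison
# lemma and the `ℓ¹` summation `∑_l 2^{5l/2} M_l ≤ C P²`

HONEST FRAMING (cell `pub-fluidc`, verbatim): *low prior, high value-of-information experiment on Tao's
machine paradigm; NOT a claim that NS blows up.* Support file (pure real analysis and bookkeeping on sequences of
levels; no fluid content). Towards the OPTIMAL inviscid clock of the `Ḃ^{5/2}_{2,1}` row itself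
(McCormick–Olson–Robinson–Rodrigo–Vidal-López–Zhou 2016: `‖u(t)‖_{Ḃ^{5/2}_{2,1}} ≳ (T − t)^{−1}`), whose `ℓ¹` structure
needs two tools the `ℓ²` rows did not:

* `sqrt_le_sqrt_add_integral` — **square-root comparison**: if `e, M ≥ 0` are continuous on `[s, t]` and
  `e(τ) − e(s) ≤ 2∫_s^τ √e · M` for every `τ ∈ [s, t]`, then `√e(t) ≤ √e(s) + ∫_s^t M` (the majorant
  `W = e(s) + η + 2∫√e M` has `(√W)' ≤ M`; `η → 0`) — turns the block energy balance `a_l² (t) − a_l²(s) ≤ 2∫ a_l M_l` into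
  `a_l(t) − a_l(s) ≤ ∫ M_l` without dividing by `a_l`;
* `tsum_weight52_shift_le`, `tsum_weight4_paraQ2_le`, `lipRow_summation` — for `a ≥ 0` on `ℤ` and
  `P = ∑_l 2^{5l/2} a_l`: `∑_l 2^{5l/2} a_{l+m} ≤ 2⁵ P` (`m ≥ −2`), `∑_l 2^{4l} Q_l ≤ 5·2^{20} P²`
  (`Q = paraQ2 a (2^· a)`), hence `∑_l 2^{5l/2} ((∑_{|m|≤2} a_{l+m}) P + 2^{3l/2} Q_l) ≤ (5·2⁵ + 5·2^{20}) P²` — the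
  `Ḃ^{5/2}_{2,1}`-weighted majorants of the block transfers sum to `≲ P²` (the `ℓ¹` analogue of
  `LipschitzSummation.lipschitz_summation` with `R ≤ C_B P`).

0 sorry; no definitions; no named facts.

## References

* D. S. McCormick, E. J. Olson, J. C. Robinson, J. L. Rodrigo, A. Vidal-López, Y. Zhou, SIAM J. Math. Anal. 48 (2016)
  2119–2132. [MccormickEtAl2016]
* H. Bahouri, J.-Y. Chemin, R. Danchin, Grundlehren 343 (2011), Lemma 2.100 / §2.6. [BahouriCheminDanchin2011]
-/

noncomputable section

open MeasureTheory Set Function Filter Topology intervalIntegral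
open scoped ENNReal NNReal
open Literature.Analysis.FluidPDE Literature.Analysis.FunctionSpaces
open Summit.NavierStokesRegularity.FluidComputer.RiccatiSummationTools (tsum_tsum_reindex)
open Summit.NavierStokesRegularity.FluidComputer.RiccatiSummationGen (two_rpow_add)

namespace Summit.NavierStokesRegularity.FluidComputer.LipRowTools

/-! ## The square-root comparison lemma -/

/-- **Square-root comparison.** Let `s ≤ t`, let `e` and `M` be continuous and nonnegative on `[s, t]`, and suppose
`e(τ) − e(s) ≤ 2 ∫_s^τ √(e(r)) M(r) dr` for every `τ ∈ [s, t]`. Then `√(e(t)) ≤ √(e(s)) + ∫_s^t M`. Proof: for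
`η > 0` the majorant `W(τ) = e(s) + η + 2∫_s^τ √e M` is `> 0`, dominates `e`, and `(√W)' = √e M/√W ≤ M`; let `η → 0`.
[folklore] -/
theorem sqrt_le_sqrt_add_integral {e M : ℝ → ℝ} {s t : ℝ} (hst : s ≤ t)
    (hec : ContinuousOn e (Icc s t)) (hMc : ContinuousOn M (Icc s t))
    (he0 : ∀ τ ∈ Icc s t, 0 ≤ e τ) (hM0 : ∀ τ ∈ Icc s t, 0 ≤ M τ)
    (hineq : ∀ τ ∈ Icc s t, e τ - e s ≤ 2 * ∫ r in s..τ, Real.sqrt (e r) * M r) :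
    Real.sqrt (e t) ≤ Real.sqrt (e s) + ∫ r in s..t, M r := by
  rcases hst.eq_or_lt with h | hst'
  · subst h; simp
  -- the integrands
  have hfc : ContinuousOn (fun r => Real.sqrt (e r) * M r) (Icc s t) :=
    (Real.continuous_sqrt.comp_continuousOn hec).mul hMc
  have hfint : ∀ τ ∈ Icc s t, IntervalIntegrable (fun r => Real.sqrt (e r) * M r) volume s τ := fun τ hτ =>
    (hfc.mono (Icc_subset_Icc le_rfl hτ.2)).intervalIntegrable_of_Icc hτ.1
  have hMint : ∀ τ ∈ Icc s t, IntervalIntegrable M volume s τ := fun τ hτ =>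
    (hMc.mono (Icc_subset_Icc le_rfl hτ.2)).intervalIntegrable_of_Icc hτ.1
  have hI0 : ∀ τ ∈ Icc s t, 0 ≤ ∫ r in s..τ, Real.sqrt (e r) * M r := fun τ hτ =>
    intervalIntegral.integral_nonneg hτ.1 fun r hr =>
      mul_nonneg (Real.sqrt_nonneg _) (hM0 r ⟨hr.1, hr.2.trans hτ.2⟩)
  -- for every `η > 0`: `√(e t) ≤ √(e s + η) + ∫ M`
  have hη : ∀ η : ℝ, 0 < η → Real.sqrt (e t) ≤ Real.sqrt (e s + η) + ∫ r in s..t, M r := by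
    intro η hη
    set W : ℝ → ℝ := fun τ => e s + η + 2 * ∫ r in s..τ, Real.sqrt (e r) * M r with hW
    have hWpos : ∀ τ ∈ Icc s t, 0 < W τ := fun τ hτ => by
      have := hI0 τ hτ; have := he0 s ⟨le_rfl, hst⟩; simp only [hW]; linarith
    have heW : ∀ τ ∈ Icc s t, e τ ≤ W τ := fun τ hτ => by
      have := hineq τ hτ; simp only [hW]; linarith
    -- continuity and derivative of `W`
    have hWc : ContinuousOn W (Icc s t) := by
      have hprim : ContinuousOn (fun τ => ∫ r in s..τ, Real.sqrt (e r) * M r) (Icc s t) := by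
        have hIo : IntegrableOn (fun r => Real.sqrt (e r) * M r) (uIcc s t) volume := by
          rw [uIcc_of_le hst]; exact hfc.integrableOn_Icc
        have h := intervalIntegral.continuousOn_primitive_interval hIo
        rwa [uIcc_of_le hst] at h
      exact continuousOn_const.add (continuousOn_const.mul hprim)
    have hWd : ∀ τ ∈ Ioo s t, HasDerivAt W (2 * (Real.sqrt (e τ) * M τ)) τ := by
      intro τ hτ
      have hca : ContinuousAt (fun r => Real.sqrt (e r) * M r) τ := hfc.continuousAt (Icc_mem_nhds hτ.1 hτ.2)
      have hmeas : StronglyMeasurableAtFilter (fun r => Real.sqrt (e r) * M r) (𝓝 τ) volume :=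
        (hfc.mono Ioo_subset_Icc_self).stronglyMeasurableAtFilter isOpen_Ioo τ hτ
      have h1 := intervalIntegral.integral_hasDerivAt_right (hfint τ (Ioo_subset_Icc_self hτ)) hmeas hca
      exact (h1.const_mul 2).const_add (e s + η)
    -- `ψ = √W − ∫ M` is non-increasing
    set ψ : ℝ → ℝ := fun τ => Real.sqrt (W τ) - ∫ r in s..τ, M r with hψ
    have hMprimc : ContinuousOn (fun τ => ∫ r in s..τ, M r) (Icc s t) := by
      have hIo : IntegrableOn M (uIcc s t) volume := by rw [uIcc_of_le hst]; exact hMc.integrableOn_Icc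
      have h := intervalIntegral.continuousOn_primitive_interval hIo
      rwa [uIcc_of_le hst] at h
    have hψc : ContinuousOn ψ (Icc s t) := (Real.continuous_sqrt.comp_continuousOn hWc).sub hMprimc
    have hψd : ∀ τ ∈ Ioo s t,
        HasDerivAt ψ (2 * (Real.sqrt (e τ) * M τ) / (2 * Real.sqrt (W τ)) - M τ) τ := by
      intro τ hτ
      have hWτ : 0 < W τ := hWpos τ (Ioo_subset_Icc_self hτ)
      have h1 := (hWd τ hτ).sqrt hWτ.ne'
      have hca : ContinuousAt M τ := hMc.continuousAt (Icc_mem_nhds hτ.1 hτ.2)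
      have hmeas : StronglyMeasurableAtFilter M (𝓝 τ) volume :=
        (hMc.mono Ioo_subset_Icc_self).stronglyMeasurableAtFilter isOpen_Ioo τ hτ
      have h2 := intervalIntegral.integral_hasDerivAt_right (hMint τ (Ioo_subset_Icc_self hτ)) hmeas hca
      exact h1.sub h2
    have hψ' : ∀ τ ∈ interior (Icc s t), deriv ψ τ ≤ 0 := by
      rw [interior_Icc]
      intro τ hτ
      rw [(hψd τ hτ).deriv]
      have hτI := Ioo_subset_Icc_self hτ
      have hWτ : 0 < W τ := hWpos τ hτI
      have hsW : 0 < Real.sqrt (W τ) := Real.sqrt_pos.2 hWτ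
      have hle : Real.sqrt (e τ) ≤ Real.sqrt (W τ) := Real.sqrt_le_sqrt (heW τ hτI)
      have hMτ := hM0 τ hτI
      rw [show 2 * (Real.sqrt (e τ) * M τ) / (2 * Real.sqrt (W τ)) = Real.sqrt (e τ) / Real.sqrt (W τ) * M τ by
        field_simp]
      have hratio : Real.sqrt (e τ) / Real.sqrt (W τ) ≤ 1 := (div_le_one hsW).2 hle
      nlinarith
    have hψdiff : DifferentiableOn ℝ ψ (interior (Icc s t)) := by
      rw [interior_Icc]
      intro τ hτ
      exact (hψd τ hτ).differentiableAt.differentiableWithinAt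
    have hanti := antitoneOn_of_deriv_nonpos (convex_Icc s t) hψc hψdiff hψ'
    have hmono := hanti (left_mem_Icc.2 hst) (right_mem_Icc.2 hst) hst
    -- unpack: `√(W t) − ∫ M ≤ √(W s) = √(e s + η)`
    have hWs : W s = e s + η := by simp [hW]
    simp only [hψ, hWs, intervalIntegral.integral_same, sub_zero] at hmono
    have h3 : Real.sqrt (e t) ≤ Real.sqrt (W t) := Real.sqrt_le_sqrt (heW t (right_mem_Icc.2 hst))
    linarith
  -- `η → 0`
  refine le_of_forall_pos_le_add fun ε hε => ?_
  have h := hη (ε ^ 2) (by positivity)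
  have hsq : Real.sqrt (e s + ε ^ 2) ≤ Real.sqrt (e s) + ε := by
    have hes := he0 s ⟨le_rfl, hst⟩
    rw [Real.sqrt_le_left (by positivity)]
    nlinarith [Real.sq_sqrt hes, Real.sqrt_nonneg (e s)]
  linarith

/-! ## The `ℓ¹` summation at the weight `2^{5l/2}` -/

variable (a : ℤ → ℝ≥0∞)

/-- The shifted `Ḃ^{5/2}_{2,1}` row: `∑_l 2^{5l/2} a_{l+m} = 2^{−5m/2} ∑_l 2^{5l/2} a_l ≤ 2⁵ · ∑_l 2^{5l/2} a_l` for `m ≥ −2`.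
[folklore] -/
theorem tsum_weight52_shift_le (m : ℤ) (hm : -2 ≤ m) :
    ∑' l : ℤ, (2 : ℝ≥0∞) ^ ((5 / 2 : ℝ) * (l : ℝ)) * a (l + m) ≤
      (2 : ℝ≥0∞) ^ (5 : ℝ) * ∑' l : ℤ, (2 : ℝ≥0∞) ^ ((5 / 2 : ℝ) * (l : ℝ)) * a l := by
  have hre : ∀ l : ℤ, (2 : ℝ≥0∞) ^ ((5 / 2 : ℝ) * (l : ℝ)) * a (l + m) =
      (2 : ℝ≥0∞) ^ (-(5 / 2 : ℝ) * (m : ℝ)) * ((2 : ℝ≥0∞) ^ ((5 / 2 : ℝ) * ((l + m : ℤ) : ℝ)) * a (l + m)) := by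
    intro l
    rw [← mul_assoc, ← two_rpow_add]
    congr 2; push_cast; ring
  rw [tsum_congr hre, ENNReal.tsum_mul_left]
  have hshift : ∑' l : ℤ, (2 : ℝ≥0∞) ^ ((5 / 2 : ℝ) * ((l + m : ℤ) : ℝ)) * a (l + m) =
      ∑' l : ℤ, (2 : ℝ≥0∞) ^ ((5 / 2 : ℝ) * (l : ℝ)) * a l :=
    (Equiv.addRight m).tsum_eq (fun l => (2 : ℝ≥0∞) ^ ((5 / 2 : ℝ) * (l : ℝ)) * a l)
  rw [hshift]
  refine mul_le_mul' (ENNReal.rpow_le_rpow_of_exponent_le (by norm_num) ?_) le_rfl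
  have hm' : (-2 : ℝ) ≤ m := by exact_mod_cast hm
  nlinarith

/-- **The fine-pairs sum at the `Ḃ^{5/2}_{2,1}` weight**: `∑_l 2^{4l} Q_l ≤ 5·2^{20} (∑_l 2^{5l/2} a_l)²`,
`Q_l = paraQ2 a (2^· a) l = ∑_{l' ≥ l−4, |m| ≤ 2} a_{l'} 2^{l'+m} a_{l'+m}` (reindex to the fine level, `∑_{l ≤ l'+4} 2^{4l} ≤ 2^{4l'+17}`,
`2^{5l'} a_{l'} a_{l'+m} ≤ 2^{−5m/2} (2^{5l'/2}a_{l'}) · P`). [folklore] -/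
theorem tsum_weight4_paraQ2_le :
    ∑' l : ℤ, (2 : ℝ≥0∞) ^ ((4 : ℝ) * (l : ℝ)) * paraQ2 a (fun k => (2 : ℝ≥0∞) ^ k * a k) l ≤
      5 * (2 : ℝ≥0∞) ^ (20 : ℝ) * (∑' l : ℤ, (2 : ℝ≥0∞) ^ ((5 / 2 : ℝ) * (l : ℝ)) * a l) ^ 2 := by
  set P : ℝ≥0∞ := ∑' l : ℤ, (2 : ℝ≥0∞) ^ ((5 / 2 : ℝ) * (l : ℝ)) * a l with hP
  set x : ℤ → ℝ≥0∞ := fun k => (2 : ℝ≥0∞) ^ ((5 / 2 : ℝ) * (k : ℝ)) * a k with hx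
  set F : ℤ → ℤ → ℤ → ℝ≥0∞ := fun m j l => (2 : ℝ≥0∞) ^ ((4 : ℝ) * (j : ℝ)) * (a l * ((2 : ℝ≥0∞) ^ (l + m) * a (l + m)))
    with hF
  have hstep1 : ∑' l : ℤ, (2 : ℝ≥0∞) ^ ((4 : ℝ) * (l : ℝ)) * paraQ2 a (fun k => (2 : ℝ≥0∞) ^ k * a k) l =
      ∑ m ∈ Finset.Icc (-2 : ℤ) 2, ∑' j : ℤ, ∑' n : ℕ, F m j (j - 4 + n) := by
    calc ∑' j : ℤ, (2 : ℝ≥0∞) ^ ((4 : ℝ) * (j : ℝ)) * paraQ2 a (fun k => (2 : ℝ≥0∞) ^ k * a k) j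
        = ∑' j : ℤ, ∑' n : ℕ, ∑ m ∈ Finset.Icc (-2 : ℤ) 2, F m j (j - 4 + n) := by
          refine tsum_congr fun j => ?_
          simp only [paraQ2]
          rw [← ENNReal.tsum_mul_left]
          refine tsum_congr fun n => ?_
          simp only [hF, Finset.mul_sum]
      _ = ∑ m ∈ Finset.Icc (-2 : ℤ) 2, ∑' j : ℤ, ∑' n : ℕ, F m j (j - 4 + n) := by
          rw [← Summable.tsum_finsetSum (fun _ _ => ENNReal.summable)]
          refine tsum_congr fun j => ?_
          exact Summable.tsum_finsetSum (fun _ _ => ENNReal.summable)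
  -- the geometric factor over the coarse index: `∑_n 2^{4(l+4−n)} ≤ 2^{4l+17}`
  have hgeom : ∀ l : ℤ, ∑' n : ℕ, (2 : ℝ≥0∞) ^ ((4 : ℝ) * (((l + 4 - n : ℤ)) : ℝ)) ≤ (2 : ℝ≥0∞) ^ ((4 : ℝ) * (l : ℝ) + 17) := by
    intro l
    have hre : ∀ n : ℕ, (2 : ℝ≥0∞) ^ ((4 : ℝ) * (((l + 4 - n : ℤ)) : ℝ)) =
        (2 : ℝ≥0∞) ^ ((4 : ℝ) * (l : ℝ) + 16) * ((2 : ℝ≥0∞) ^ (-(4 : ℝ))) ^ n := by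
      intro n
      rw [← ENNReal.rpow_natCast, ← ENNReal.rpow_mul, ← two_rpow_add]
      congr 1; push_cast; ring
    rw [tsum_congr hre, ENNReal.tsum_mul_left]
    have hq : ∑' n : ℕ, ((2 : ℝ≥0∞) ^ (-(4 : ℝ))) ^ n ≤ 2 := by
      have hle : (2 : ℝ≥0∞) ^ (-(4 : ℝ)) ≤ 2⁻¹ := by
        rw [← ENNReal.rpow_neg_one]
        exact ENNReal.rpow_le_rpow_of_exponent_le (by norm_num) (by norm_num)
      calc ∑' n : ℕ, ((2 : ℝ≥0∞) ^ (-(4 : ℝ))) ^ n ≤ ∑' n : ℕ, ((2 : ℝ≥0∞)⁻¹) ^ n :=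
            ENNReal.tsum_le_tsum fun n => pow_le_pow_left' hle n
        _ = 2 := by rw [ENNReal.tsum_geometric, ENNReal.one_sub_inv_two, inv_inv]
    calc (2 : ℝ≥0∞) ^ ((4 : ℝ) * (l : ℝ) + 16) * ∑' n : ℕ, ((2 : ℝ≥0∞) ^ (-(4 : ℝ))) ^ n
        ≤ (2 : ℝ≥0∞) ^ ((4 : ℝ) * (l : ℝ) + 16) * 2 := mul_le_mul' le_rfl hq
      _ = (2 : ℝ≥0∞) ^ ((4 : ℝ) * (l : ℝ) + 17) := by
          rw [show (4 : ℝ) * (l : ℝ) + 17 = ((4 : ℝ) * (l : ℝ) + 16) + 1 by ring,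
            two_rpow_add ((4 : ℝ) * (l : ℝ) + 16) 1, ENNReal.rpow_one]
  have hm_bound : ∀ m ∈ Finset.Icc (-2 : ℤ) 2, ∑' j : ℤ, ∑' n : ℕ, F m j (j - 4 + n) ≤ (2 : ℝ≥0∞) ^ (20 : ℝ) * P ^ 2 := by
    intro m hm
    rw [Finset.mem_Icc] at hm
    rw [tsum_tsum_reindex (F m)]
    have hsplit : ∀ l : ℤ, ∑' n : ℕ, F m (l + 4 - n) l =
        (∑' n : ℕ, (2 : ℝ≥0∞) ^ ((4 : ℝ) * (((l + 4 - n : ℤ)) : ℝ))) * (a l * ((2 : ℝ≥0∞) ^ (l + m) * a (l + m))) := by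
      intro l
      rw [← ENNReal.tsum_mul_right]
    -- `2^{4l+17} a_l 2^{l+m} a_{l+m} = 2^{17} 2^{m − 5m/2}·... ≤ 2^{20} x_l x_{l+m} 2^{-5m/2}`-style identity
    have hcoef : ∀ l : ℤ, (2 : ℝ≥0∞) ^ ((4 : ℝ) * (l : ℝ) + 17) * (a l * ((2 : ℝ≥0∞) ^ (l + m) * a (l + m))) =
        (2 : ℝ≥0∞) ^ (17 - (3 / 2 : ℝ) * (m : ℝ)) * (x l * x (l + m)) := by
      intro l
      rw [← ENNReal.rpow_intCast _ (l + m)]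
      have epow : (2 : ℝ≥0∞) ^ ((4 : ℝ) * (l : ℝ) + 17) * (2 : ℝ≥0∞) ^ (((l + m : ℤ) : ℝ)) =
          (2 : ℝ≥0∞) ^ (17 - (3 / 2 : ℝ) * (m : ℝ)) *
            ((2 : ℝ≥0∞) ^ ((5 / 2 : ℝ) * (l : ℝ)) * (2 : ℝ≥0∞) ^ ((5 / 2 : ℝ) * ((l + m : ℤ) : ℝ))) := by
        rw [← two_rpow_add, ← two_rpow_add, ← two_rpow_add]
        congr 1; push_cast; ring
      calc (2 : ℝ≥0∞) ^ ((4 : ℝ) * (l : ℝ) + 17) * (a l * ((2 : ℝ≥0∞) ^ (((l + m : ℤ) : ℝ)) * a (l + m)))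
          = ((2 : ℝ≥0∞) ^ ((4 : ℝ) * (l : ℝ) + 17) * (2 : ℝ≥0∞) ^ (((l + m : ℤ) : ℝ))) * (a l * a (l + m)) := by ring
        _ = _ := by rw [epow, hx]; ring
    have hpow : (2 : ℝ≥0∞) ^ (17 - (3 / 2 : ℝ) * (m : ℝ)) ≤ (2 : ℝ≥0∞) ^ (20 : ℝ) := by
      have hm1 : (-2 : ℝ) ≤ m := by exact_mod_cast hm.1
      refine ENNReal.rpow_le_rpow_of_exponent_le (by norm_num) ?_
      nlinarith
    -- `∑_l x_l x_{l+m} ≤ P · P`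
    have hxx : ∑' l : ℤ, x l * x (l + m) ≤ P * P := by
      calc ∑' l : ℤ, x l * x (l + m) ≤ ∑' l : ℤ, x l * P :=
            ENNReal.tsum_le_tsum fun l => mul_le_mul' le_rfl (ENNReal.le_tsum (l + m))
        _ = P * P := by rw [ENNReal.tsum_mul_right]
    calc ∑' l : ℤ, ∑' n : ℕ, F m (l + 4 - n) l
        = ∑' l : ℤ, (∑' n : ℕ, (2 : ℝ≥0∞) ^ ((4 : ℝ) * (((l + 4 - n : ℤ)) : ℝ))) *
            (a l * ((2 : ℝ≥0∞) ^ (l + m) * a (l + m))) := tsum_congr hsplit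
      _ ≤ ∑' l : ℤ, (2 : ℝ≥0∞) ^ ((4 : ℝ) * (l : ℝ) + 17) * (a l * ((2 : ℝ≥0∞) ^ (l + m) * a (l + m))) :=
          ENNReal.tsum_le_tsum fun l => mul_le_mul' (hgeom l) le_rfl
      _ = ∑' l : ℤ, (2 : ℝ≥0∞) ^ (17 - (3 / 2 : ℝ) * (m : ℝ)) * (x l * x (l + m)) := tsum_congr hcoef
      _ = (2 : ℝ≥0∞) ^ (17 - (3 / 2 : ℝ) * (m : ℝ)) * ∑' l : ℤ, x l * x (l + m) := ENNReal.tsum_mul_left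
      _ ≤ (2 : ℝ≥0∞) ^ (20 : ℝ) * (P * P) := mul_le_mul' hpow hxx
      _ = (2 : ℝ≥0∞) ^ (20 : ℝ) * P ^ 2 := by rw [sq]
  calc _ = ∑ m ∈ Finset.Icc (-2 : ℤ) 2, ∑' j : ℤ, ∑' n : ℕ, F m j (j - 4 + n) := hstep1
    _ ≤ ∑ m ∈ Finset.Icc (-2 : ℤ) 2, (2 : ℝ≥0∞) ^ (20 : ℝ) * P ^ 2 := Finset.sum_le_sum hm_bound
    _ = 5 * ((2 : ℝ≥0∞) ^ (20 : ℝ) * P ^ 2) := by rw [Finset.sum_const]; simp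
    _ = 5 * (2 : ℝ≥0∞) ^ (20 : ℝ) * P ^ 2 := by ring

/-- **THE `ℓ¹` SUMMATION AT THE `Ḃ^{5/2}_{2,1}` WEIGHT.** For `a ≥ 0` on `ℤ` and `P = ∑_l 2^{5l/2} a_l`:
`∑_l 2^{5l/2} ((∑_{|m|≤2} a_{l+m}) · P + 2^{3l/2} Q_l) ≤ (5·2⁵ + 5·2^{20}) · P²`, `Q = paraQ2 a (2^· a)` — the
`2^{5l/2}`-weighted majorants of the block transfers (`|N_l| ≤ A a_l (∑_m a_{l+m} T_{l+m} + C_B 2^{3l/2} Q_l)`, `T ≤ C_B P`)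
sum to `≲ P²`: the `Ḃ^{5/2}_{2,1}` row obeys `P' ≲ P²`. [cite: MccormickEtAl2016, Thm. 1.1] [cite: BahouriCheminDanchin2011, Lemma 2.100] -/
theorem lipRow_summation :
    ∑' l : ℤ, (2 : ℝ≥0∞) ^ ((5 / 2 : ℝ) * (l : ℝ)) *
        ((∑ m ∈ Finset.Icc (-2 : ℤ) 2, a (l + m)) * (∑' k : ℤ, (2 : ℝ≥0∞) ^ ((5 / 2 : ℝ) * (k : ℝ)) * a k) +
          (2 : ℝ≥0∞) ^ ((3 / 2 : ℝ) * (l : ℝ)) * paraQ2 a (fun k => (2 : ℝ≥0∞) ^ k * a k) l) ≤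
      (5 * (2 : ℝ≥0∞) ^ (5 : ℝ) + 5 * (2 : ℝ≥0∞) ^ (20 : ℝ)) *
        (∑' k : ℤ, (2 : ℝ≥0∞) ^ ((5 / 2 : ℝ) * (k : ℝ)) * a k) ^ 2 := by
  set P : ℝ≥0∞ := ∑' k : ℤ, (2 : ℝ≥0∞) ^ ((5 / 2 : ℝ) * (k : ℝ)) * a k with hP
  have hsplit : ∑' l : ℤ, (2 : ℝ≥0∞) ^ ((5 / 2 : ℝ) * (l : ℝ)) *
      ((∑ m ∈ Finset.Icc (-2 : ℤ) 2, a (l + m)) * P +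
        (2 : ℝ≥0∞) ^ ((3 / 2 : ℝ) * (l : ℝ)) * paraQ2 a (fun k => (2 : ℝ≥0∞) ^ k * a k) l) =
      (∑ m ∈ Finset.Icc (-2 : ℤ) 2, (∑' l : ℤ, (2 : ℝ≥0∞) ^ ((5 / 2 : ℝ) * (l : ℝ)) * a (l + m)) * P) +
        ∑' l : ℤ, (2 : ℝ≥0∞) ^ ((4 : ℝ) * (l : ℝ)) * paraQ2 a (fun k => (2 : ℝ≥0∞) ^ k * a k) l := by
    have hterm : ∀ l : ℤ, (2 : ℝ≥0∞) ^ ((5 / 2 : ℝ) * (l : ℝ)) *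
        ((∑ m ∈ Finset.Icc (-2 : ℤ) 2, a (l + m)) * P +
          (2 : ℝ≥0∞) ^ ((3 / 2 : ℝ) * (l : ℝ)) * paraQ2 a (fun k => (2 : ℝ≥0∞) ^ k * a k) l) =
        (∑ m ∈ Finset.Icc (-2 : ℤ) 2, (2 : ℝ≥0∞) ^ ((5 / 2 : ℝ) * (l : ℝ)) * a (l + m) * P) +
          (2 : ℝ≥0∞) ^ ((4 : ℝ) * (l : ℝ)) * paraQ2 a (fun k => (2 : ℝ≥0∞) ^ k * a k) l := by
      intro l
      have e4 : (2 : ℝ≥0∞) ^ ((5 / 2 : ℝ) * (l : ℝ)) * (2 : ℝ≥0∞) ^ ((3 / 2 : ℝ) * (l : ℝ)) =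
          (2 : ℝ≥0∞) ^ ((4 : ℝ) * (l : ℝ)) := by rw [← two_rpow_add]; congr 1; ring
      rw [mul_add, Finset.sum_mul, Finset.mul_sum, ← mul_assoc, e4]
      congr 1
      exact Finset.sum_congr rfl fun m _ => by ring
    rw [tsum_congr hterm, ENNReal.tsum_add, Summable.tsum_finsetSum (fun _ _ => ENNReal.summable)]
    congr 1
    refine Finset.sum_congr rfl fun m _ => ?_
    rw [ENNReal.tsum_mul_right]
  rw [hsplit]
  have hL : ∑ m ∈ Finset.Icc (-2 : ℤ) 2, (∑' l : ℤ, (2 : ℝ≥0∞) ^ ((5 / 2 : ℝ) * (l : ℝ)) * a (l + m)) * P ≤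
      ∑ m ∈ Finset.Icc (-2 : ℤ) 2, (2 : ℝ≥0∞) ^ (5 : ℝ) * P * P := by
    refine Finset.sum_le_sum fun m hm => ?_
    rw [Finset.mem_Icc] at hm
    exact mul_le_mul' (tsum_weight52_shift_le a m hm.1) le_rfl
  have hH := tsum_weight4_paraQ2_le a
  calc _ ≤ (∑ m ∈ Finset.Icc (-2 : ℤ) 2, (2 : ℝ≥0∞) ^ (5 : ℝ) * P * P) + 5 * (2 : ℝ≥0∞) ^ (20 : ℝ) * P ^ 2 :=
        add_le_add hL hH
    _ = (5 * (2 : ℝ≥0∞) ^ (5 : ℝ) + 5 * (2 : ℝ≥0∞) ^ (20 : ℝ)) * P ^ 2 := by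
        rw [Finset.sum_const]
        simp
        ring

end Summit.NavierStokesRegularity.FluidComputer.LipRowTools

end
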